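import Summits.BirchSwinnertonDyer.BirchSwinnertonDyer.Theses.SlopeDichotomyA2
import Literature.NumberTheory.EllipticCurves.PadicSigmaThreeExistence
import HarnessLib

/-!
# Route `SlopeDichotomyA2` (rung I1-weaken, corner A2): `PublishedInputsA2` is FIVE named facts —
# the Mazur–Tate `σ` conjunct is a tree THEOREM

Support file (prover seat `bsd-schneider-i1-c2`, gen 11, cell `bsd-schneider-ideate`; `--supports
stmt-BirchSwinnertonDyer-19087`). THEOREMS ONLY; nothing about any curve is asserted; BSD is not
advanced.

The support item `PublishedInputsA2` (stmt-BirchSwinnertonDyer-19087) of route `SlopeDichotomyA2` is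
the conjunction of the SIX published inputs of the kernel's corner-A2 theorem
`X1.bsdp_of_typeBRankOne_of_schneider`: Greenberg–Vatsal 2000 Thm. (1.3)
(`GreenbergVatsal2000.thm13_charIdeal_eq_of_gvPar`), Schneider 1985 / Balakrishnan–Müller–Stein 2015
Thm. 1.7 (`Schneider1985_order_charGenerator_odd`), Perrin-Riou 1987 §1.4
(`perrinRiou_rankOne_leadingTerms_odd`), Mazur–Stein–Tate 2006 Thm. 1.3 / Mazur–Tate 1991 Thm. 3.1
(`mazur_tate_sigma_exists_odd`), modularity (`nonempty_modularParametrizationData`) and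
Gross–Zagier–Kolyvagin (`rank_eq_analyticRank_of_analyticRank_le_one`). The fourth is no longer an
input: it is the tree THEOREM `Literature.NumberTheory.EllipticCurves.mazur_tate_sigma_exists_odd_holds`
(`PadicSigmaThreeExistence.lean`: Blakestad–Grant for `p ≥ 5`, the Frobenius-lift argument at `p = 3`).
This file records the consequence for the route BY NAME:

* `publishedInputsA2_iff_five` — item 19087 ⟺ the conjunction of the FIVE remaining named facts;
  `publishedInputsA2_of_five` — the constructor.
* `typeBRankOneUnridered_of_degenerateLocusA2_of_five` — the route's deciding theorem
  (`Theses.SlopeDichotomyA2.closes`) with the `σ`-input discharged: crux `DegenerateLocusA2`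
  (item 19086) + five facts ⟹ the rung-I1 leaf.
* `typeBRankOneUnridered_iff_degenerateLocusA2_of_five` — the honesty lemma of
  `Theorems/SchneiderWeakenLeaf.lean` (`SchneiderWeaken.leaf_iff_degenerateLocus_of_inputs`) modulo
  FIVE facts: the crux is the leaf's whole open content.
* `typeBRankOneUnridered_of_schneider_of_five`, `bsdp_of_typeBRankOne_of_schneider_of_five` — the
  kernel's α-road (Schneider rider) with the `σ`-input discharged, class-wide and at a pair.

References: [MazurSteinTate2006] Thm. 1.3; [MazurTate1991] Thm. 3.1; [BlakestadGrant2023] Thm. 1,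
Thm. 15; [GreenbergVatsal2000] Thm. (1.3); [Schneider1985] §2; [PerrinRiou1987] §1.4.
-/

set_option autoImplicit false
-- the Theorems namespace of a single-conjunct summit repeats the summit name by design (D-0017)
set_option linter.dupNamespace false

noncomputable section

open scoped Classical

namespace Summit.BirchSwinnertonDyer.BirchSwinnertonDyer.Theorems.SlopeDichotomyA2PublishedInputs

open WeierstrassCurve Literature.NumberTheory.EllipticCurves
  Literature.NumberTheory.EllipticCurves.ModularForms
  Summit.BirchSwinnertonDyer.Rank1Residual
  Summit.BirchSwinnertonDyer.BirchSwinnertonDyer.Theorems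
  Summit.BirchSwinnertonDyer.BirchSwinnertonDyer.Theses

/-- **Item 19087 is five named facts.** `PublishedInputsA2` ⟺ Greenberg–Vatsal Thm. (1.3) ∧
Schneider 1985 (order / generator) ∧ Perrin-Riou 1987 (rank-one leading terms) ∧ modularity ∧ GZK;
the Mazur–Tate `σ`-existence conjunct is supplied by the tree theorem
`mazur_tate_sigma_exists_odd_holds`. [cite: MazurSteinTate2006, Thm. 1.3] -/
theorem publishedInputsA2_iff_five :
    SlopeDichotomyA2.PublishedInputsA2 ↔
      (GreenbergVatsal2000.thm13_charIdeal_eq_of_gvPar ∧ Schneider1985_order_charGenerator_odd ∧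
        perrinRiou_rankOne_leadingTerms_odd ∧ nonempty_modularParametrizationData ∧
          rank_eq_analyticRank_of_analyticRank_le_one) := by
  unfold SlopeDichotomyA2.PublishedInputsA2
  exact ⟨fun h ↦ ⟨h.1, h.2.1, h.2.2.1, h.2.2.2.2.1, h.2.2.2.2.2⟩,
    fun h ↦ ⟨h.1, h.2.1, h.2.2.1, mazur_tate_sigma_exists_odd_holds, h.2.2.2.1, h.2.2.2.2⟩⟩

/-- **Constructor of item 19087 from the five remaining named facts** (the `σ`-input discharged by
`mazur_tate_sigma_exists_odd_holds`). [cite: MazurSteinTate2006, Thm. 1.3] -/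
theorem publishedInputsA2_of_five (hGV : GreenbergVatsal2000.thm13_charIdeal_eq_of_gvPar)
    (hS : Schneider1985_order_charGenerator_odd) (hPR : perrinRiou_rankOne_leadingTerms_odd)
    (hmod : nonempty_modularParametrizationData)
    (hGZK : rank_eq_analyticRank_of_analyticRank_le_one) :
    SlopeDichotomyA2.PublishedInputsA2 :=
  publishedInputsA2_iff_five.2 ⟨hGV, hS, hPR, hmod, hGZK⟩

/-- **The route's deciding theorem with the `σ`-input discharged**: the crux `DegenerateLocusA2`
(item stmt-BirchSwinnertonDyer-19086, by name) and the FIVE named published facts give the rung-I1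
leaf `SchneiderWeaken.TypeBRankOneUnridered` — `Theses.SlopeDichotomyA2.closes` fed by
`publishedInputsA2_of_five`. Conditional result (five named facts + the open crux); credits nothing.
[cite: GreenbergVatsal2000, Thm. (1.3)] -/
theorem typeBRankOneUnridered_of_degenerateLocusA2_of_five
    (h2 : SlopeDichotomyA2.DegenerateLocusA2)
    (hGV : GreenbergVatsal2000.thm13_charIdeal_eq_of_gvPar)
    (hS : Schneider1985_order_charGenerator_odd) (hPR : perrinRiou_rankOne_leadingTerms_odd)
    (hmod : nonempty_modularParametrizationData)
    (hGZK : rank_eq_analyticRank_of_analyticRank_le_one) :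
    SchneiderWeaken.TypeBRankOneUnridered :=
  SlopeDichotomyA2.closes h2 (publishedInputsA2_of_five hGV hS hPR hmod hGZK)

/-- **Honesty lemma modulo FIVE facts**: granted Greenberg–Vatsal, Schneider 1985, Perrin-Riou 1987,
modularity and GZK, the rung-I1 leaf is EQUIVALENT to the crux `DegenerateLocusA2` (item 19086) —
`SchneiderWeaken.leaf_iff_degenerateLocus_of_inputs` with `mazur_tate_sigma_exists_odd_holds`; the
route crux and the `SchneiderWeaken` crux are the same text. [cite: MazurSteinTate2006, Thm. 1.3] -/
theorem typeBRankOneUnridered_iff_degenerateLocusA2_of_five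
    (hGV : GreenbergVatsal2000.thm13_charIdeal_eq_of_gvPar)
    (hS : Schneider1985_order_charGenerator_odd) (hPR : perrinRiou_rankOne_leadingTerms_odd)
    (hmod : nonempty_modularParametrizationData)
    (hGZK : rank_eq_analyticRank_of_analyticRank_le_one) :
    SchneiderWeaken.TypeBRankOneUnridered ↔ SlopeDichotomyA2.DegenerateLocusA2 :=
  ⟨fun h W _ _ p _ hB _ ↦ h W p hB,
    fun h2 ↦ typeBRankOneUnridered_of_degenerateLocusA2_of_five h2 hGV hS hPR hmod hGZK⟩

/-- **The kernel's α-road with the `σ`-input discharged, class-wide**: Schneider non-degeneracy of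
THE canonical height at every corner-A2 pair + the five named facts ⟹ the leaf
(`SchneiderWeaken.leaf_of_rider` with `mazur_tate_sigma_exists_odd_holds`).
[cite: Schneider1985, §2] [cite: GreenbergVatsal2000, Thm. (1.3)] -/
theorem typeBRankOneUnridered_of_schneider_of_five
    (hGV : GreenbergVatsal2000.thm13_charIdeal_eq_of_gvPar)
    (hS : Schneider1985_order_charGenerator_odd) (hPR : perrinRiou_rankOne_leadingTerms_odd)
    (hmod : nonempty_modularParametrizationData)
    (hGZK : rank_eq_analyticRank_of_analyticRank_le_one)
    (hSch : ∀ (W : WeierstrassCurve ℚ) [W.IsElliptic] [W.IsGloballyMinimal] (p : ℕ) [Fact p.Prime],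
      X1.TypeBRankOne W p → ∀ Dh : PAdicHeightData W p, Dh.IsCanonical → SchneiderConjecture Dh) :
    SchneiderWeaken.TypeBRankOneUnridered :=
  SchneiderWeaken.leaf_of_rider hGV hS hPR mazur_tate_sigma_exists_odd_holds hmod hGZK hSch

/-- **The kernel's α-road with the `σ`-input discharged, at a pair**: for a corner-A2 pair `(W, p)`
whose every canonical `p`-adic height datum satisfies Schneider's conjecture, `BSD(W,p)` from the five
named facts (`X1.bsdp_of_typeBRankOne_of_schneider` with `mazur_tate_sigma_exists_odd_holds`).
[cite: Schneider1985, §2] [cite: PerrinRiou1987, §1.4] -/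
theorem bsdp_of_typeBRankOne_of_schneider_of_five
    (hGV : GreenbergVatsal2000.thm13_charIdeal_eq_of_gvPar)
    (hS : Schneider1985_order_charGenerator_odd) (hPR : perrinRiou_rankOne_leadingTerms_odd)
    (hmod : nonempty_modularParametrizationData)
    (hGZK : rank_eq_analyticRank_of_analyticRank_le_one)
    (W : WeierstrassCurve ℚ) [W.IsElliptic] [W.IsGloballyMinimal] (p : ℕ) [Fact p.Prime]
    (hB : X1.TypeBRankOne W p)
    (hSch : ∀ Dh : PAdicHeightData W p, Dh.IsCanonical → SchneiderConjecture Dh) :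
    BSDp W p :=
  X1.bsdp_of_typeBRankOne_of_schneider hGV hS hPR mazur_tate_sigma_exists_odd_holds hmod hGZK W p hB
    hSch

end Summit.BirchSwinnertonDyer.BirchSwinnertonDyer.Theorems.SlopeDichotomyA2PublishedInputs

end
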